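import Literature.MathematicalPhysics.QuantumFieldTheory.Balaban1983to89.HaarExponentialChart
import Mathlib.MeasureTheory.Function.Jacobian

/-!
# `Balaban1983to89.HaarExponentialChartDensity` — [Helgason2000] Ch. I §1 Thm. 1.14 (13) at MEASURE level, file 2 of 4:
# the density `|det jac| = |det((1 − e^{−adX})/adX)|` and the chart measure `ν_s = Θ_*(|det jac X| dλ(X)|_{B(0,s)})`

statement-level skeleton of published theorems with citation tags; proofs where landed; nothing here is a claim
about the Yang–Mills mass gap

Mega-formalization `lit-balaban` (HOME `run/shared/lean/pub/lit-balaban/`), unit `lit-balaban-p28` (Phase-2 proof seat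
p28, gen 10; free-target protocol G.5-34(d)).  Companion of `HaarExponentialChart` (file 1: the chart `Θ`, the window
`V_s`, the transition maps `T_k`; TARGET, CITATION HEADER and SETTING there): [Helgason2000] Ch. I §1 Theorem 1.14 (13)
p. 96 *«∫_G f(g) dg = ∫_𝔤 f(exp X) det((1 − e^{−adX})/adX) dX»* for `f` supported in the canonical coordinate
neighbourhood, print's [Balaban1985UV3] p. 260 *«dU′ = σ(A′)dA′ = σ₀ σ/σ₀ (A′)dA′, σ₀ = σ(0), where dA′ is the Lebesque
measure on g … Generally σ(A) is an analytic, positive, even function of A in a neighbourhood of 0∈g»*.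

CONTENT (0 sorry, no named fact, axioms standard; `jac` = r10's `B13HaarSigmaJacobian.jac` over `ℝ`).
* §1 THE DENSITY `jacDensity x = |det jac x| : ℝ≥0∞` for any `ad`-stable finite-dimensional real subspace `𝔤` of a real
  normed algebra: `continuous_det_jac` (through r10's `det_jac_real_eq_sigmaRel` — `det jac x = Re σrel([ad_𝔤(−x)]⊗ℂ)` —
  and `B13HaarSigma.continuous_sigmaRel`), `measurable_jacDensity`, `jacDensity_zero` (`= 1`: «σ₀ = σ(0)», i.e.
  `σ/σ₀ = |det jac|` is normalised at the unit), `eventually_half_le_jacDensity`, `exists_jacDensity_le_of_isCompact`,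
  `exists_ball_det_jac_pos` («positive … in a neighbourhood of 0∈g», r10's `eventually_det_jac_pos`).
* §2 THE CHART MEASURE `chartMeasure h hlie λ s = Θ_*((λ|_{B(0,s)}).withDensity |det jac|)` on `G` for a measure `λ`
  on `𝔤` (print's `(σ/σ₀)(A′)dA′` pushed to the group): `chartMeasure_apply`, **`lintegral_chartMeasure`**
  (`∫ F dν_s = ∫_{‖X‖<s} F(Θ X) |det jac X| dλ(X)` — the right-hand side of (13)), `chartMeasure_window`,
  `chartMeasure_compl_window` (carried by `V_s`), `chartMeasure_window_lt_top`, `chartMeasure_window_ne_zero`.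
Files 3–4 (`HaarExponentialChartCocycle`, `HaarExponentialChartMeasure`): local left-invariance of `ν_s` on the
window and `μ|_{V_s} = (μ V_s / ν_s V_s) • ν_s` for every Haar measure `μ` of `G`.

HONEST SCOPE.  (i) The density is `|det jac|`; `det jac > 0` (absolute value dropped) only on the ball of
`exists_ball_det_jac_pos`.  (ii) «analytic» and «even» are r10's/r07's files (`B13HaarSigmaJacobian`,
`B10Eq18SigmaEven`), not restated; «invariant under the adjoint representation» is r10's `det_jac_Adg`.  (iii) The
constant `σ₀` of a given Haar measure is not evaluated (for `SU(2)`: `1/2π²`, r07's `B10Eq18SigmaSU2Haar`).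
Failed printed steps: none.

## References
* S. Helgason, *Groups and Geometric Analysis*, AMS Math. Surveys Monogr. 83 (2000), Ch. I §1 Thm. 1.14, p. 96.
  [Helgason2000]
* T. Bałaban, Commun. Math. Phys. **102** (1985) 255–275, p. 260. [Balaban1985UV3]
-/

noncomputable section

open NormedSpace Set Function Filter Topology MeasureTheory
open scoped ENNReal NNReal

namespace Literature.MathematicalPhysics.QuantumFieldTheory.Balaban1983to89.HaarExponentialChart

/-! ## §1 The density `|det jac|`: continuity, measurability, normalisation at `0`, positivity near `0` -/

section Density

open scoped Matrix.Norms.Operator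
open B13HaarSigmaJacobian (jac adg adgₗ det_jac_real_eq_sigmaRel det_jac_zero eventually_det_jac_pos)
open B13HaarSigma (sigmaRel continuous_sigmaRel)

variable {𝔸 : Type*} [NormedRing 𝔸] [NormedAlgebra ℝ 𝔸]
variable {𝔤 : Submodule ℝ 𝔸} [FiniteDimensional ℝ 𝔤]
  (hlie : ∀ x ∈ 𝔤, ∀ y ∈ 𝔤, x * y - y * x ∈ 𝔤)

/-- **`x ↦ det jac(x)` is continuous on `𝔤`** («σ(A) is an analytic … function of A»; continuity through r10's
`det_jac_real_eq_sigmaRel`: `det jac x = Re σrel([ad_𝔤(−x)]_b ⊗ ℂ)`, `σrel` entire).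
[cite: Helgason2000, Ch. I §1 Thm. 1.14 (12) p. 96] [cite: Balaban1985UV3, p. 260] -/
theorem continuous_det_jac : Continuous fun x : 𝔤 => LinearMap.det (jac hlie x : 𝔤 →ₗ[ℝ] 𝔤) := by
  classical
  let b := Module.finBasis ℝ 𝔤
  let Aₗ : 𝔤 →ₗ[ℝ] Matrix (Fin (Module.finrank ℝ 𝔤)) (Fin (Module.finrank ℝ 𝔤)) ℝ :=
    ((LinearMap.toMatrix b b).toLinearMap ∘ₗ ContinuousLinearMap.coeLM ℝ) ∘ₗ (adgₗ hlie) ∘ₗ (-LinearMap.id)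
  have hA : ∀ y : 𝔤, Aₗ y = LinearMap.toMatrix b b (adg hlie (-y) : 𝔤 →ₗ[ℝ] 𝔤) := fun y => rfl
  have hc : Continuous Aₗ := LinearMap.continuous_of_finiteDimensional Aₗ
  have hmap : Continuous fun x : 𝔤 => (Aₗ x).map (algebraMap ℝ ℂ) := hc.matrix_map Complex.continuous_ofReal
  have h2 : Continuous fun x : 𝔤 => (sigmaRel ((Aₗ x).map (algebraMap ℝ ℂ))).re :=
    Complex.continuous_re.comp (continuous_sigmaRel.comp hmap)
  refine h2.congr fun x => ?_
  rw [hA, ← det_jac_real_eq_sigmaRel hlie b x]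
  exact Complex.ofReal_re _

/-- THE DENSITY of (12)–(13) as an `ℝ≥0∞`-valued function: `jacDensity x = |det jac x| = |det((1 − e^{−ad x})/ad x)|`
(print's `σ(A)/σ₀`). [cite: Helgason2000, Ch. I §1 Thm. 1.14 (12) p. 96] [cite: Balaban1985UV3, p. 260] -/
def jacDensity (x : 𝔤) : ℝ≥0∞ := ENNReal.ofReal |LinearMap.det (jac hlie x : 𝔤 →ₗ[ℝ] 𝔤)|

/-- Unfolding `jacDensity`. [cite: Helgason2000, Ch. I §1 Thm. 1.14 (12) p. 96] -/
theorem jacDensity_def (x : 𝔤) :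
    jacDensity hlie x = ENNReal.ofReal |LinearMap.det (jac hlie x : 𝔤 →ₗ[ℝ] 𝔤)| := rfl

/-- The density is continuous. [cite: Helgason2000, Ch. I §1 Thm. 1.14 (12) p. 96] -/
theorem continuous_jacDensity : Continuous (jacDensity hlie) :=
  ENNReal.continuous_ofReal.comp (continuous_abs.comp (continuous_det_jac hlie))

/-- The density is Borel measurable. [cite: Helgason2000, Ch. I §1 Thm. 1.14 (12) p. 96] -/
theorem measurable_jacDensity [MeasurableSpace 𝔤] [BorelSpace 𝔤] : Measurable (jacDensity hlie) :=
  (continuous_jacDensity hlie).measurable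

/-- `jacDensity 0 = 1` («σ₀ = σ(0)»: `σ/σ₀ = |det jac|` is `1` at the unit).
[cite: Helgason2000, Ch. I §1 Thm. 1.14 (12) p. 96] [cite: Balaban1985UV3, p. 260] -/
theorem jacDensity_zero : jacDensity hlie 0 = 1 := by
  rw [jacDensity, det_jac_zero, abs_one, ENNReal.ofReal_one]

/-- `|det jac| ≥ 1/2` on a neighbourhood of `0`. [cite: Helgason2000, Ch. I §1 Thm. 1.14 (12) p. 96] -/
theorem eventually_half_le_jacDensity : ∀ᶠ x in 𝓝 (0 : 𝔤), (1 / 2 : ℝ≥0∞) ≤ jacDensity hlie x := by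
  have h := (continuous_jacDensity hlie).tendsto 0
  rw [jacDensity_zero] at h
  have h12 : (1 / 2 : ℝ≥0∞) < 1 := by
    rw [one_div]; exact ENNReal.inv_lt_one.2 (by norm_num)
  exact (h.eventually (Ioi_mem_nhds h12)).mono fun x hx => le_of_lt hx

/-- The density is bounded on compact sets. [cite: Helgason2000, Ch. I §1 Thm. 1.14 (12) p. 96] -/
theorem exists_jacDensity_le_of_isCompact {K : Set 𝔤} (hK : IsCompact K) :
    ∃ M : ℝ≥0, ∀ x ∈ K, jacDensity hlie x ≤ M := by
  obtain ⟨M, hM⟩ := hK.exists_bound_of_continuousOn (continuous_det_jac hlie).continuousOn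
  refine ⟨Real.toNNReal M, fun x hx => ?_⟩
  have hx' : |LinearMap.det (jac hlie x : 𝔤 →ₗ[ℝ] 𝔤)| ≤ M := by
    have := hM x hx; rwa [Real.norm_eq_abs] at this
  rw [jacDensity, ENNReal.ofReal, ENNReal.coe_le_coe]
  exact Real.toNNReal_le_toNNReal hx'

/-- **«σ(A) is … positive … in a neighbourhood of 0∈g»**: `det jac x > 0` for `‖x‖ < s₀`, some `s₀ > 0` (r10's
`eventually_det_jac_pos`). [cite: Balaban1985UV3, p. 260] [cite: Helgason2000, Ch. I §1 Thm. 1.14 (12) p. 96] -/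
theorem exists_ball_det_jac_pos : ∃ s₀ : ℝ, 0 < s₀ ∧ ∀ x : 𝔤, ‖x‖ < s₀ →
    0 < LinearMap.det (jac hlie x : 𝔤 →ₗ[ℝ] 𝔤) := by
  classical
  have h := eventually_det_jac_pos hlie (Module.finBasis ℝ 𝔤)
  obtain ⟨ε, hε, hball⟩ := Metric.eventually_nhds_iff.1 h
  exact ⟨ε, hε, fun x hx => hball (by rwa [dist_zero_right])⟩

end Density

/-! ## §2 The chart measure `ν_s = Θ_*(|det jac X| dλ(X)|_{B(0,s)})` -/

namespace IsChartRep

section ChartMeasure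

open B13HaarSigmaJacobian (jac)

variable {𝔸 : Type*} [NormedRing 𝔸] [NormedAlgebra ℂ 𝔸] [CompleteSpace 𝔸]
variable {G : Type*} [Group G] [TopologicalSpace G] [CompactSpace G]
variable {C : LogChart 𝔸} {ρ : G →* 𝔸} (h : IsChartRep C ρ) [FiniteDimensional ℝ C.lie]
  (hlie : ∀ x ∈ C.lie, ∀ y ∈ C.lie, x * y - y * x ∈ C.lie)
variable [MeasurableSpace C.lie] [BorelSpace C.lie] (η : Measure C.lie)
variable [MeasurableSpace G] [BorelSpace G]

omit [FiniteDimensional ℝ C.lie] in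
/-- `Θ` is Borel measurable. [cite: Helgason2000, Ch. I §1 Thm. 1.14 (13) p. 96] -/
theorem measurable_expChart : Measurable h.expChart := h.continuous_expChart.measurable

omit [CompleteSpace 𝔸] [CompactSpace G] [BorelSpace C.lie] [BorelSpace G] in
/-- THE CHART MEASURE `ν_s := Θ_*(|det jac X| dλ(X)|_{B(0,s)})` on `G` (print's `(σ/σ₀)(A′) dA′` pushed to the group).
[cite: Helgason2000, Ch. I §1 Thm. 1.14 (13) p. 96] [cite: Balaban1985UV3, p. 260] -/
def chartMeasure (h : IsChartRep C ρ) (hlie : ∀ x ∈ C.lie, ∀ y ∈ C.lie, x * y - y * x ∈ C.lie)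
    (η : Measure C.lie) (s : ℝ) : Measure G :=
  ((η.restrict (Metric.ball (0 : C.lie) s)).withDensity (jacDensity hlie)).map h.expChart

omit [CompleteSpace 𝔸] [CompactSpace G] [BorelSpace C.lie] [BorelSpace G] in
/-- The chart measure is s-finite (for s-finite `λ`). [cite: Helgason2000, Ch. I §1 Thm. 1.14 (13) p. 96] -/
instance sFinite_chartMeasure (s : ℝ) [SFinite η] : SFinite (h.chartMeasure hlie η s) := by
  unfold chartMeasure; infer_instance

/-- `ν_s(B) = ∫_{B(0,s) ∩ Θ⁻¹B} |det jac| dλ`. [cite: Helgason2000, Ch. I §1 Thm. 1.14 (13) p. 96] -/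
theorem chartMeasure_apply {s : ℝ} {B : Set G} (hB : MeasurableSet B) :
    h.chartMeasure hlie η s B = ∫⁻ X in Metric.ball 0 s ∩ h.expChart ⁻¹' B, jacDensity hlie X ∂η := by
  rw [chartMeasure, Measure.map_apply h.measurable_expChart hB,
    withDensity_apply _ (h.measurable_expChart hB), Measure.restrict_restrict (h.measurable_expChart hB),
    Set.inter_comm]

/-- **`∫ F dν_s = ∫_{‖X‖<s} F(Θ X) |det jac X| dλ(X)`** — the right-hand side of (13).
[cite: Helgason2000, Ch. I §1 Thm. 1.14 (13) p. 96] -/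
theorem lintegral_chartMeasure (s : ℝ) {F : G → ℝ≥0∞} (hF : Measurable F) :
    ∫⁻ g, F g ∂(h.chartMeasure hlie η s) = ∫⁻ X in Metric.ball 0 s, F (h.expChart X) * jacDensity hlie X ∂η := by
  rw [chartMeasure, lintegral_map hF h.measurable_expChart]
  have h1 := lintegral_withDensity_eq_lintegral_mul (η.restrict (Metric.ball 0 s)) (measurable_jacDensity hlie)
    (hF.comp h.measurable_expChart)
  simp only [Function.comp_apply, Pi.mul_apply] at h1
  rw [h1]
  exact lintegral_congr fun X => mul_comm _ _

/-- `ν_s(V_s) = ∫_{‖X‖<s} |det jac| dλ`. [cite: Helgason2000, Ch. I §1 Thm. 1.14 (13) p. 96] -/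
theorem chartMeasure_window {s : ℝ} (hs : s ≤ chartRadius C) :
    h.chartMeasure hlie η s (h.window s) = ∫⁻ X in Metric.ball 0 s, jacDensity hlie X ∂η := by
  rw [h.chartMeasure_apply hlie η (h.isOpen_window hs).measurableSet]
  have : Metric.ball (0 : C.lie) s ∩ h.expChart ⁻¹' (h.window s) = Metric.ball 0 s :=
    Set.inter_eq_left.2 fun X hX => h.expChart_mem_window hX
  rw [this]

/-- `ν_s` is carried by the window: `ν_s(V_sᶜ) = 0`. [cite: Helgason2000, Ch. I §1 Thm. 1.14 (13) p. 96] -/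
theorem chartMeasure_compl_window {s : ℝ} (hs : s ≤ chartRadius C) : h.chartMeasure hlie η s (h.window s)ᶜ = 0 := by
  rw [h.chartMeasure_apply hlie η (h.isOpen_window hs).measurableSet.compl]
  have : Metric.ball (0 : C.lie) s ∩ h.expChart ⁻¹' (h.window s)ᶜ = ∅ := by
    ext X
    simp only [mem_inter_iff, mem_preimage, mem_compl_iff, mem_empty_iff_false, iff_false, not_and, not_not]
    exact fun hX => h.expChart_mem_window hX
  rw [this, Measure.restrict_empty, lintegral_zero_measure]

/-- `ν_s(V_s) < ∞` (the density is continuous, the ball relatively compact, `λ` finite on compacts).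
[cite: Helgason2000, Ch. I §1 Thm. 1.14 (13) p. 96] -/
theorem chartMeasure_window_lt_top [IsFiniteMeasureOnCompacts η] {s : ℝ} (hs : s ≤ chartRadius C) :
    h.chartMeasure hlie η s (h.window s) < ∞ := by
  rw [h.chartMeasure_window hlie η hs]
  obtain ⟨M, hM⟩ := exists_jacDensity_le_of_isCompact hlie (isCompact_closedBall (0 : C.lie) s)
  calc ∫⁻ X in Metric.ball 0 s, jacDensity hlie X ∂η
      ≤ ∫⁻ X in Metric.ball 0 s, (M : ℝ≥0∞) ∂η :=
        setLIntegral_mono measurable_const fun X hX => hM X (Metric.ball_subset_closedBall hX)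
    _ = M * η (Metric.ball 0 s) := setLIntegral_const _ _
    _ < ∞ := ENNReal.mul_lt_top ENNReal.coe_lt_top
        ((measure_mono Metric.ball_subset_closedBall).trans_lt (isCompact_closedBall (0 : C.lie) s).measure_lt_top)

/-- `ν_s(V_s) ≠ 0` for `s > 0` (`|det jac| ≥ 1/2` near `0`, `λ` charges open balls).
[cite: Helgason2000, Ch. I §1 Thm. 1.14 (13) p. 96] -/
theorem chartMeasure_window_ne_zero [η.IsOpenPosMeasure] {s : ℝ} (hs0 : 0 < s) (hs : s ≤ chartRadius C) :
    h.chartMeasure hlie η s (h.window s) ≠ 0 := by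
  rw [h.chartMeasure_window hlie η hs]
  obtain ⟨ε, hε, hball⟩ := Metric.eventually_nhds_iff.1 (eventually_half_le_jacDensity hlie)
  have hsub : Metric.ball (0 : C.lie) (min s ε) ⊆ Metric.ball 0 s := Metric.ball_subset_ball (min_le_left _ _)
  have hpos : 0 < η (Metric.ball (0 : C.lie) (min s ε)) := Metric.measure_ball_pos η 0 (lt_min hs0 hε)
  have h1 : (1 / 2 : ℝ≥0∞) * η (Metric.ball (0 : C.lie) (min s ε)) ≤
      ∫⁻ X in Metric.ball 0 s, jacDensity hlie X ∂η :=
    calc (1 / 2 : ℝ≥0∞) * η (Metric.ball (0 : C.lie) (min s ε))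
        = ∫⁻ X in Metric.ball (0 : C.lie) (min s ε), (1 / 2 : ℝ≥0∞) ∂η := (setLIntegral_const _ _).symm
      _ ≤ ∫⁻ X in Metric.ball (0 : C.lie) (min s ε), jacDensity hlie X ∂η :=
          setLIntegral_mono (measurable_jacDensity hlie) fun X hX =>
            hball (by rw [dist_zero_right]; exact lt_of_lt_of_le (mem_ball_zero_iff.1 hX) (min_le_right _ _))
      _ ≤ ∫⁻ X in Metric.ball 0 s, jacDensity hlie X ∂η := lintegral_mono_set hsub
  intro h0
  rw [h0, nonpos_iff_eq_zero, mul_eq_zero] at h1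
  rcases h1 with h1 | h1
  · exact absurd h1 (by norm_num)
  · exact hpos.ne' h1

end ChartMeasure

end IsChartRep

end Literature.MathematicalPhysics.QuantumFieldTheory.Balaban1983to89.HaarExponentialChart
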